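import Mathlib.Analysis.SpecialFunctions.Log.Base
import Literature.Computability.MetaComplexity.ProbabilisticPolynomial
import Literature.Computability.MetaComplexity.ThresholdProbDegreeStep
import Literature.Computability.MetaComplexity.SmolenskyCharacter
import HarnessLib

/-!
# The probabilistic degree of threshold functions (Srinivasan–Tripathi–Venkitesh 2021, Thm. 18)

A NAMED FACT (D-0014): the main technical upper bound of Srinivasan–Tripathi–Venkitesh,
*On the probabilistic degrees of symmetric Boolean functions* (FSTTCS 2019 / SIAM J. Discrete
Math. 2021), Theorem 18 — every `(n,t)`-threshold tuple `(Thr_n^{t_1}, …, Thr_n^{t_m})`, `t_i ≤ t`,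
has `ε`-error probabilistic degree `O(√(t log(1/ε)) + log(1/ε))` over fields of positive
characteristic — vendored in the EXPLICIT form its proof establishes (§3.1.1, p. 8: constants
`A_p = B_p = 6 400 000·p`, error range `ε ∈ (0, 2^{-100})`), over the prime field `𝔽_p`, in the
vocabulary of `ProbabilisticPolynomial.lean` (`HasProbDegree`, STV Def. 16).

This is Grewal–Kumar 2024's Lemma 3.5, the input of their Lemma 3.6 (a `G(k)` gate has an
`ε`-probabilistic polynomial of degree `O(k + log(1/ε))`) and hence of the ADDITIVE-degree form of
their Razborov–Smolensky lemma for `GC⁰(k)[p]` (Thm. 3.8); the tree's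
`RazborovSmolenskyBall*.lean` prove the product form without it.

* `thrFn n t` — the threshold function (`= (GateFn.thr n t).2`);
* `stvConst p = 6.4·10⁶·p`, `stvDegree p t ε = ⌊A_p√(t·log₂(1/ε)) + B_p·log₂(1/ε)⌋`;
* `STV2021_thresholdProbDegree` — the fact; `STV2021_thresholdProbDegree.single` — `m = 1`.

Reading conventions (each a WEAKENING of the printed claim, never a strengthening): `log` read as
`log₂`; the field specialised to `ZMod p`; `n ≥ 1` as in "positive `n`".

Discharge (DONE, `STV2021_thresholdProbDegree_holds` at the end of this file, 2026-08-27): the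
printed induction on `n` (§3.1.1) run over uniform seed families — hashing base case and
subsampling step proved in `ThresholdProbDegreeStep.lean`, window interpolant over `𝔽_p` by Lucas
(`ThresholdWindowPolynomial.lean`, replacing Alman–Williams' determinant), Chernoff counts
(`Probability/Independence/ChernoffProductCount.lean`, replacing Bernstein's inequality).

## References

* S. Srinivasan, U. Tripathi, S. Venkitesh, *On the probabilistic degrees of symmetric Boolean
  functions*, SIAM J. Discrete Math. 35(3) (2021) 2070–2092; FSTTCS 2019; arXiv:1910.02465 —
  Def. 16, Def. 17, Theorem 18, §3.1.1 [SrinivasanTripathiVenkitesh2021].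
* S. Grewal, V. M. Kumar, arXiv:2408.16406 (2024), Lemma 3.5 [GrewalKumar2024].
-/

noncomputable section

namespace Literature.Computability.MetaComplexity

open Finset Literature.Computability.Complexity

namespace Smolensky

/-! ### Threshold functions and the Srinivasan–Tripathi–Venkitesh degree bound -/

/-- The threshold Boolean function `Thr_n^t`: accepts exactly the inputs of Hamming weight at
least `t` (STV 2021, §2; the truth table of the tree's gate `GateFn.thr n t`).
[cite: SrinivasanTripathiVenkitesh2021, §2 (Some Boolean functions)] -/
def thrFn (n t : ℕ) : (Fin n → Bool) → Bool := fun x => decide (t ≤ GateFn.numOnes x)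

/-- `thrFn` is the truth table of the threshold gate `GateFn.thr`. [cite: SrinivasanTripathiVenkitesh2021, §2 (Some Boolean functions)] -/
theorem thrFn_eq_thr (n t : ℕ) : thrFn n t = (GateFn.thr n t).2 := rfl

/-- The constant `A_p = B_p = 6 400 000 · p` of the proof of STV 2021, Thm. 18 (positive
characteristic `p`; "we make no effort to optimize the constants").
[cite: SrinivasanTripathiVenkitesh2021, Theorem 18 (proof, §3.1.1)] -/
def stvConst (p : ℕ) : ℝ := 6400000 * p

/-- The STV degree bound `A_p·√(t·log₂(1/ε)) + B_p·log₂(1/ε)`, rounded down (a degree is an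
integer). We read the paper's `log` as `log₂`; if it is `ln` the printed bound is smaller, so this
reading only WEAKENS the vendored statement. [cite: SrinivasanTripathiVenkitesh2021, Theorem 18 (proof, §3.1.1)] -/
def stvDegree (p t : ℕ) (ε : ℝ) : ℕ :=
  ⌊stvConst p * Real.sqrt (t * Real.logb 2 (1 / ε)) + stvConst p * Real.logb 2 (1 / ε)⌋₊

/-- **Srinivasan–Tripathi–Venkitesh 2021, Theorem 18 (positive characteristic), in the
explicit form established by its proof (§3.1.1, p. 8), specialised to the prime field `𝔽_p`:**
for every prime `p`, all `n ≥ 1`, `t ≤ n`, every `(n,t)`-threshold tuple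
`T = (Thr_n^{t_1}, …, Thr_n^{t_m})` (`t_i ≤ t`, Def. 17) and every `ε ∈ (0, 2^{-100})`, `T` has an
`ε`-error probabilistic poly-tuple over `𝔽_p` (Def. 16) of degree at most
`A_p√(t log(1/ε)) + B_p log(1/ε)` with `A_p = B_p = 6 400 000·p` — i.e. `pdeg_ε(T) ≤ stvDegree p t ε`.
(Printed headline: `pdeg_ε(T) = O(√(t log(1/ε)) + log(1/ε))` for `ε ∈ (0,1/3)`, the range
`[2^{-100}, 1/3)` being reached by error reduction, Fact 6; the theorem holds over every field of
characteristic `p` — TODO(general form): `CharP F p`.) Proof in the source: induction on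
`(n, t, ε)` via Alman–Williams interpolants `Ex_{[a,b]}` (Thm. 21), a hashing base case for
`ε ≤ 2^{-t/160000}` (random hash `[n] → [r]`, `r = 6.4·10⁶ log(1/ε)`, random `𝔽_p`-linear forms,
Bernstein's inequality Lemma 20). Used by Grewal–Kumar 2024, Lemma 3.5/3.6 (`G(k)` gates have
probabilistic degree `O(k + log(1/ε))`). NOT proved here (a NAMED FACT, D-0014).
[cite: SrinivasanTripathiVenkitesh2021, Theorem 18] -/
def STV2021_thresholdProbDegree : Prop :=
  ∀ (p : ℕ) [Fact p.Prime] (n t m : ℕ) (ts : Fin m → ℕ), 0 < n → t ≤ n → (∀ i, ts i ≤ t) →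
    ∀ ε : ℝ, 0 < ε → ε < 1 / 2 ^ 100 →
      HasProbDegree (ZMod p) (fun i => thrFn n (ts i)) ε (stvDegree p t ε)

/-- The single-threshold case of the STV bound: `pdeg_ε(Thr_n^t) ≤ stvDegree p t ε` for
`ε < 2^{-100}` (from the named fact). [cite: SrinivasanTripathiVenkitesh2021, Theorem 18] -/
theorem STV2021_thresholdProbDegree.single (h : STV2021_thresholdProbDegree) (p : ℕ) [Fact p.Prime]
    {n t : ℕ} (hn : 0 < n) (ht : t ≤ n) {ε : ℝ} (hε : 0 < ε) (hε' : ε < 1 / 2 ^ 100) :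
    HasProbDegree (ZMod p) (fun _ : Fin 1 => thrFn n t) ε (stvDegree p t ε) :=
  h p n t 1 (fun _ => t) hn ht (fun _ => le_rfl) ε hε hε'

/-! ### Discharge of the named fact (qn-lit g15, 2026-08-27): the proof of STV 2021, Thm. 18

The printed induction (§3.1.1) with sampling rate `1/16`, run on the two constructions of
`ThresholdProbDegreeStep.lean` (`ufam_thr_hash`, `ufam_thr_step`) and closed into `HasProbDegree`
by `hasProbDegree_of_ufam`. The three regimes at `(n, t, ε)`, `L = log₂(1/ε) > 100`,
`C = A_p = B_p = 6.4·10⁶·p`: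
* `n ≤ C·L`: the exact representation (degree `n`);
* `t < 160000·L`: the hashing base case with `r = max(40t, 128(⌊L⌋ + 2)) ≤ 6.4·10⁶·L` buckets
  (degree `r·p ≤ C·L`, error `2^{-r} + e^{-r/128} ≤ ε`);
* `t ≥ 160000·L`: the inductive step with `θ = ¾√(tL)`, `Δ = ⌈θ⌉ + 2`, `W = 32Δ`, one recursive
  call on `⌈n/16⌉ < n` variables with thresholds `≤ ⌈t/16⌉ + Δ ≤ 0.0644·t` and error `ε/2`;
  the degree recursion `3·D(⌈t/16⌉+Δ, ε/2) ≤ D(t, ε)` and `2·D(…) + p(2W+1) ≤ D(t,ε)` hold because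
  `√((⌈t/16⌉+Δ)(L+1)) ≤ 0.26·√(tL)` and `√(tL) ≥ 400·L`. -/

section Discharge

open Real

/-! #### Real-analysis helpers -/

/-- `e^{-x} ≤ 2^{-x}` for `x ≥ 0`. [folklore] -/
private theorem exp_neg_le_two_rpow_neg {x : ℝ} (hx : 0 ≤ x) : Real.exp (-x) ≤ (2 : ℝ) ^ (-x) := by
  rw [Real.rpow_def_of_pos two_pos]
  refine Real.exp_le_exp.2 ?_
  have h2 : Real.log 2 < 1 := by
    have := Real.log_lt_sub_one_of_pos two_pos (by norm_num : (2 : ℝ) ≠ 1); linarith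
  have h0 : 0 < Real.log 2 := Real.log_pos one_lt_two
  nlinarith

/-- For `0 < ε < 2^{-100}`: `L = log₂(1/ε) > 100` and `ε = 2^{-L}`. [folklore] -/
private theorem logb_facts {ε : ℝ} (hε : 0 < ε) (hε' : ε < 1 / 2 ^ 100) :
    100 < Real.logb 2 (1 / ε) ∧ ε = (2 : ℝ) ^ (-Real.logb 2 (1 / ε)) := by
  have h1ε : 0 < 1 / ε := by positivity
  constructor
  · rw [Real.lt_logb_iff_rpow_lt one_lt_two h1ε]
    have h : (2 : ℝ) ^ (100 : ℝ) = 2 ^ (100 : ℕ) := by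
      rw [show (100 : ℝ) = ((100 : ℕ) : ℝ) by norm_num, Real.rpow_natCast]
    rw [h, lt_one_div (by positivity) hε]
    exact hε'
  · rw [Real.rpow_neg zero_le_two, Real.rpow_logb two_pos (by norm_num) h1ε, one_div, inv_inv]

/-- `2^{-(L+k)} = 2^{-L} · 2^{-k}`. [folklore] -/
private theorem two_rpow_neg_add (L k : ℝ) : (2 : ℝ) ^ (-(L + k)) = (2 : ℝ) ^ (-L) * (2 : ℝ) ^ (-k) := by
  rw [neg_add, Real.rpow_add two_pos]

/-- `e^{-(L+1)} ≤ ε/2` and `e^{-(L+2)} ≤ ε/4` and `2^{-r} ≤ ε/2` for `r ≥ L + 1`, when `ε = 2^{-L}`,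
`L ≥ 0`. [folklore] -/
private theorem small_of_logb {ε L : ℝ} (hεL : ε = (2 : ℝ) ^ (-L)) (hL : 0 ≤ L) :
    Real.exp (-(L + 1)) ≤ ε / 2 ∧ Real.exp (-(L + 2)) ≤ ε / 4 ∧
      ∀ r : ℕ, L + 1 ≤ r → (1 / 2 : ℝ) ^ r ≤ ε / 2 := by
  have h1 : (2 : ℝ) ^ (-(1 : ℝ)) = 1 / 2 := by
    rw [Real.rpow_neg zero_le_two, Real.rpow_one]; norm_num
  have h2 : (2 : ℝ) ^ (-(2 : ℝ)) = 1 / 4 := by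
    rw [Real.rpow_neg zero_le_two, show (2 : ℝ) = ((2 : ℕ) : ℝ) by norm_num, Real.rpow_natCast]
    norm_num
  refine ⟨?_, ?_, fun r hr => ?_⟩
  · refine (exp_neg_le_two_rpow_neg (by linarith)).trans ?_
    rw [two_rpow_neg_add, ← hεL, h1]; linarith
  · refine (exp_neg_le_two_rpow_neg (by linarith)).trans ?_
    rw [two_rpow_neg_add, ← hεL, h2]; linarith
  · have h3 : (1 / 2 : ℝ) ^ r = (2 : ℝ) ^ (-(r : ℝ)) := by
      rw [Real.rpow_neg zero_le_two, Real.rpow_natCast, one_div, inv_pow]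
    rw [h3]
    calc (2 : ℝ) ^ (-(r : ℝ)) ≤ (2 : ℝ) ^ (-(L + 1)) :=
          Real.rpow_le_rpow_of_exponent_le one_le_two (by linarith)
      _ = ε / 2 := by rw [two_rpow_neg_add, ← hεL, h1]; ring

/-- `stvDegree` dominates every natural number below the real bound. [cite: SrinivasanTripathiVenkitesh2021, Theorem 18 (proof: the degree bound A_p√(t log(1/ε)) + B_p log(1/ε))] -/
private theorem le_stvDegree {p t d : ℕ} {ε : ℝ}
    (h : (d : ℝ) ≤ stvConst p * Real.sqrt (t * Real.logb 2 (1 / ε)) + stvConst p * Real.logb 2 (1 / ε)) :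
    d ≤ stvDegree p t ε :=
  Nat.le_floor h

/-- `√(tL)` lies between `400·L` and `t/400` when `t ≥ 160000·L`, `L ≥ 0`. [cite: SrinivasanTripathiVenkitesh2021, Theorem 18 (proof: "uses the fact that log(1/ε) ≤ t/160000")] -/
private theorem sqrt_bounds {t L : ℝ} (hL : 0 ≤ L) (ht : 160000 * L ≤ t) :
    400 * L ≤ Real.sqrt (t * L) ∧ Real.sqrt (t * L) ≤ t / 400 := by
  have ht0 : 0 ≤ t := le_trans (by positivity) ht
  constructor
  · have h : (400 * L) ^ 2 ≤ t * L := by nlinarith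
    calc 400 * L = Real.sqrt ((400 * L) ^ 2) := (Real.sqrt_sq (by positivity)).symm
      _ ≤ Real.sqrt (t * L) := Real.sqrt_le_sqrt h
  · have h : t * L ≤ (t / 400) ^ 2 := by nlinarith
    calc Real.sqrt (t * L) ≤ Real.sqrt ((t / 400) ^ 2) := Real.sqrt_le_sqrt h
      _ = t / 400 := Real.sqrt_sq (by positivity)

/-- The light-input deviation exponent: `L + 2 ≤ θ²/(4 μ_max)` for `θ = ¾√(tL)`,
`μ_max ≤ t/8 + 2θ + 9`, `t ≥ 160000 L`, `L ≥ 100`. [cite: SrinivasanTripathiVenkitesh2021, Theorem 18 (proof: the Bernstein estimate "≤ 2exp(−100 t log(1/ε)/(2t)) ≤ ε/4")] -/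
private theorem deviation_exponent {t L s θ μ : ℝ} (hL : 100 ≤ L) (ht : 160000 * L ≤ t)
    (hs2 : s ^ 2 = t * L) (hst : s ≤ t / 400) (hθ : θ = 3 / 4 * s)
    (hμ : μ ≤ t / 8 + 2 * θ + 9) (hμ0 : 0 < μ) : L + 2 ≤ θ ^ 2 / (4 * μ) := by
  rw [le_div_iff₀ (by positivity), hθ]
  have ht0 : 0 ≤ t := le_trans (by positivity) ht
  have h1 : 4 * μ ≤ t / 2 + 6 * s + 36 := by linarith
  have h2 : (L + 2) * (4 * μ) ≤ (L + 2) * (t / 2 + 6 * s + 36) :=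
    mul_le_mul_of_nonneg_left h1 (by linarith)
  have h3 : s * L ≤ t / 400 * L := mul_le_mul_of_nonneg_right hst (by linarith)
  have h4 : 100 * t ≤ t * L := by nlinarith
  nlinarith

/-- The recursive threshold is small: `t'(L+1) ≤ 0.26²·tL` for `t' ≤ t/16 + θ + 4`.
[cite: SrinivasanTripathiVenkitesh2021, Theorem 18 (proof, Correctness of Degree: √((t/10 ± 20√(t log(1/ε))) log(4/ε)) bounds)] -/
private theorem tprime_bound {t L s θ t' : ℝ} (hL : 100 ≤ L) (ht : 160000 * L ≤ t) (hst : s ≤ t / 400)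
    (hθ : θ = 3 / 4 * s) (ht' : t' ≤ t / 16 + θ + 4) :
    t' * (L + 1) ≤ (26 / 100) ^ 2 * (t * L) := by
  have ht0 : 0 ≤ t := le_trans (by positivity) ht
  have h1 : t' ≤ t / 16 + 3 * t / 1600 + 4 := by rw [hθ] at ht'; linarith
  have h2 : t' * (L + 1) ≤ (t / 16 + 3 * t / 1600 + 4) * (L + 1) :=
    mul_le_mul_of_nonneg_right h1 (by linarith)
  have h4 : 100 * t ≤ t * L := by nlinarith
  nlinarith

/-- The degree recursion with `C = 6.4·10⁶·p`: if `D' ≤ C(0.26 s + L + 1)` and the window degree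
is `≤ p(48 s + 193)`, then `2D' + max(window, D') ≤ C(s + L)` (`s ≥ 400L`, `L ≥ 100`).
[cite: SrinivasanTripathiVenkitesh2021, Theorem 18 (proof, Correctness of Degree: "(√(38/100) + √(1/10)) A_p √(t log(4/ε)) + 3B_p log(4/ε) ≤ A_p√(t log(1/ε)) + B_p log(1/ε)")] -/
private theorem degree_recursion {p D' Dw : ℕ} {L s : ℝ} (hp2 : 2 ≤ (p : ℝ)) (hL : 100 ≤ L)
    (hs400 : 400 * L ≤ s)
    (hD' : (D' : ℝ) ≤ 6400000 * p * (26 / 100 * s) + 6400000 * p * (L + 1))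
    (hDw : (Dw : ℝ) ≤ p * (48 * s + 193)) :
    ((2 * D' + max Dw D' : ℕ) : ℝ) ≤ 6400000 * p * s + 6400000 * p * L := by
  have hp0 : 0 ≤ (p : ℝ) := by linarith
  rcases le_total Dw D' with hmax | hmax
  · rw [max_eq_right hmax]
    push_cast
    have h1 : 0 ≤ 22 / 100 * s - 2 * L - 3 := by linarith
    nlinarith [mul_nonneg hp0 h1]
  · rw [max_eq_left hmax]
    push_cast
    have h1 : 0 ≤ 3071952 * s - 6400000 * L - 12800193 := by nlinarith
    nlinarith [mul_nonneg hp0 h1]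

/-! #### The induction -/

/-- Monotonicity of `⌈·/16⌉`. [folklore] -/
private theorem sub16_mono {a b : ℕ} (h : a ≤ b) : sub16 a ≤ sub16 b := by
  unfold sub16; omega

/-- **STV 2021, Theorem 18 (positive characteristic), uniform-seed form, all `n`.** For every
threshold tuple with thresholds `≤ t` on `n` variables and every `ε ∈ (0, 2^{-100})` there is a
uniform seed family over `𝔽_p` of degree `≤ stvDegree p t ε = ⌊A_p√(t log₂(1/ε)) + B_p log₂(1/ε)⌋`
and error `≤ ε`. Strong induction on `n` along the printed proof (§3.1.1).
[cite: SrinivasanTripathiVenkitesh2021, Theorem 18] -/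
theorem ufam_thr_stv (p : ℕ) [hp : Fact p.Prime] (n : ℕ) :
    ∀ (κ : Type) [Fintype κ] (ts : κ → ℕ) (t : ℕ), (∀ i, ts i ≤ t) →
      ∀ ε : ℝ, 0 < ε → ε < 1 / 2 ^ 100 →
        UFam (ZMod p) (n := n) (fun i x => decide (ts i ≤ GateFn.numOnes x)) ε (stvDegree p t ε) := by
  induction n using Nat.strong_induction_on with
  | _ n ih =>
  intro κ _ ts t hts ε hε hε'
  obtain ⟨hL100, hεL⟩ := logb_facts hε hε'
  set L := Real.logb 2 (1 / ε) with hL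
  have hL0 : 0 ≤ L := by linarith
  set C : ℝ := stvConst p with hC
  have hCdef : C = 6400000 * p := rfl
  have hp2 : (2 : ℝ) ≤ p := by exact_mod_cast hp.out.two_le
  have hp0 : (0 : ℝ) ≤ p := by linarith
  have hC0 : 0 ≤ C := by rw [hCdef]; positivity
  set s := Real.sqrt (t * L) with hs
  have hs0 : 0 ≤ s := Real.sqrt_nonneg _
  have ht0 : (0 : ℝ) ≤ t := Nat.cast_nonneg _
  obtain ⟨hexp1, hexp2, hhalf⟩ := small_of_logb hεL hL0
  -- (A) few variables: the exact representation
  by_cases hA : (n : ℝ) ≤ C * L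
  · refine (ufam_exact _).mono hε.le (le_stvDegree ?_)
    rw [← hL, ← hs, ← hC]; nlinarith
  push Not at hA
  have hn2 : 2 ≤ n := by
    by_contra h
    have : (n : ℝ) ≤ 1 := by exact_mod_cast (by omega : n ≤ 1)
    nlinarith
  -- (B) small thresholds: hashing
  by_cases hB : (t : ℝ) < 160000 * L
  · set r : ℕ := max (40 * t) (128 * (⌊L⌋₊ + 2)) with hr
    have hr40 : 40 * t ≤ r := le_max_left _ _
    have hr1 : 1 ≤ r := le_trans (by omega) (le_max_right _ _)
    have hfl : (⌊L⌋₊ : ℝ) ≤ L := Nat.floor_le hL0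
    have hfl' : L < (⌊L⌋₊ : ℝ) + 1 := Nat.lt_floor_add_one L
    have hrL : L + 1 ≤ (r : ℝ) / 128 := by
      have : ((128 * (⌊L⌋₊ + 2) : ℕ) : ℝ) ≤ r := by exact_mod_cast le_max_right _ _
      push_cast at this; linarith
    have hrle : (r : ℝ) ≤ 6400000 * L := by
      rw [hr, Nat.cast_max]
      refine max_le ?_ ?_
      · push_cast; linarith
      · push_cast; nlinarith
    refine (ufam_thr_hash (p := p) (n := n) ts hts hr40 hr1).mono ?_ (le_stvDegree ?_)
    · have h1 : Real.exp (-(r : ℝ) / 128) ≤ ε / 2 := by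
        refine le_trans (Real.exp_le_exp.2 ?_) hexp1
        rw [neg_div]; linarith
      have h2 : (1 / 2 : ℝ) ^ r ≤ ε / 2 := hhalf r (by linarith)
      linarith
    · rw [← hL, ← hs, ← hC, hCdef]
      push_cast
      nlinarith
  push Not at hB
  -- (C) the inductive step
  have hn0 : 0 < n := by omega
  have hlt : sub16 n < n := by unfold sub16; omega
  obtain ⟨hs400, hst⟩ := sqrt_bounds hL0 hB
  have ht7 : (16000000 : ℝ) ≤ t := by nlinarith
  set θ : ℝ := 3 / 4 * s with hθ
  have hθ0 : 0 ≤ θ := by positivity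
  set Δ : ℕ := ⌈θ⌉₊ + 2 with hΔ
  have hΔlo : θ + 1 ≤ Δ := by
    have := Nat.le_ceil θ; rw [hΔ]; push_cast; linarith
  have hΔhi : (Δ : ℝ) ≤ θ + 3 := by
    have := Nat.ceil_lt_add_one hθ0; rw [hΔ]; push_cast; linarith
  set W : ℕ := 32 * Δ with hW
  have hW' : 16 * ((Δ : ℝ) + θ + 1) ≤ W := by rw [hW]; push_cast; linarith
  set t' : ℕ := sub16 t + Δ with ht'
  have hts' : ∀ ib : κ × Fin 3, recThr ts Δ ib ≤ t' := by
    intro ib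
    have h1 : sub16 (ts ib.1) ≤ sub16 t := sub16_mono (hts ib.1)
    unfold recThr
    split_ifs <;> omega
  have hε2 : 0 < ε / 2 := by positivity
  have hε2' : ε / 2 < 1 / 2 ^ 100 := by linarith
  -- the recursive family
  have hrec := ih (sub16 n) hlt (κ × Fin 3) (recThr ts Δ) t' hts' (ε / 2) hε2 hε2'
  -- the numeric hypotheses of the step
  set A₀ : ℕ := 2 * t + 32 * (Δ + 1) with hA₀
  have hA₀r : ((A₀ : ℕ) : ℝ) = 2 * t + 32 * ((Δ : ℝ) + 1) := by rw [hA₀]; push_cast; ring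
  set μmax : ℝ := ((A₀ : ℕ) : ℝ) / 16 + 1 with hμmax
  have hμmaxlo : (t : ℝ) / 8 ≤ μmax := by rw [hμmax, hA₀r]; linarith
  have hμmaxhi : μmax ≤ (t : ℝ) / 8 + 2 * θ + 9 := by rw [hμmax, hA₀r]; linarith
  have hμmax0 : 0 < μmax := by positivity
  have hθμ : θ ≤ 2 * μmax := by
    rw [hθ]; linarith
  have hs2 : s ^ 2 = t * L := by rw [hs]; exact Real.sq_sqrt (by positivity)
  have hkey : L + 2 ≤ θ ^ 2 / (4 * μmax) :=
    deviation_exponent hL100.le hB hs2 hst rfl hμmaxhi hμmax0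
  have hε₁a : 2 * Real.exp (-(θ ^ 2 / (4 * μmax))) ≤ ε / 2 := by
    have : Real.exp (-(θ ^ 2 / (4 * μmax))) ≤ ε / 4 :=
      le_trans (Real.exp_le_exp.2 (by linarith)) hexp2
    linarith
  have hε₁b : Real.exp (-((A₀ : ℕ) : ℝ) / 256) ≤ ε / 2 := by
    refine le_trans (Real.exp_le_exp.2 ?_) hexp1
    rw [hA₀r, neg_div]
    have : (Δ : ℝ) ≥ 0 := Nat.cast_nonneg _
    linarith
  have hstep := ufam_thr_step (p := p) hn0 ts hts hθ0 hΔlo hW' hθμ hε₁a hε₁b hrec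
  refine hstep.mono (by linarith) (le_stvDegree ?_)
  -- the degree recursion
  have hL' : Real.logb 2 (1 / (ε / 2)) = L + 1 := by
    rw [one_div_div, div_eq_mul_one_div, Real.logb_mul two_ne_zero (by positivity),
      Real.logb_self_eq_one one_lt_two, hL]
    ring
  have ht'r : (t' : ℝ) ≤ t / 16 + θ + 4 := by
    have h1 : ((16 * sub16 t : ℕ) : ℝ) ≤ t + 15 := by exact_mod_cast (sub16_bounds t).2
    rw [ht']; push_cast at h1 ⊢; linarith
  have hprod : (t' : ℝ) * (L + 1) ≤ (26 / 100) ^ 2 * (t * L) := tprime_bound hL100.le hB hst rfl ht'r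
  have hsqrt' : Real.sqrt (t' * (L + 1)) ≤ 26 / 100 * s := by
    calc Real.sqrt (t' * (L + 1)) ≤ Real.sqrt ((26 / 100) ^ 2 * (t * L)) := Real.sqrt_le_sqrt hprod
      _ = 26 / 100 * s := by
          rw [Real.sqrt_mul (by positivity), Real.sqrt_sq (by norm_num), hs]
  have hD'r : ((stvDegree p t' (ε / 2) : ℕ) : ℝ) ≤ C * (26 / 100 * s) + C * (L + 1) := by
    unfold stvDegree
    rw [hL', ← hC]
    have h0 : 0 ≤ C * Real.sqrt (t' * (L + 1)) + C * (L + 1) := by positivity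
    refine (Nat.floor_le h0).trans ?_
    exact add_le_add (mul_le_mul_of_nonneg_left hsqrt' hC0) le_rfl
  have hWr : ((p * (2 * W + 1) : ℕ) : ℝ) ≤ p * (48 * s + 193) := by
    push_cast
    rw [hW]; push_cast
    refine mul_le_mul_of_nonneg_left ?_ hp0
    rw [hθ] at hΔhi; linarith
  rw [← hL, ← hs, ← hC, hCdef]
  rw [hCdef] at hD'r
  exact degree_recursion hp2 hL100.le hs400 hD'r hWr

/-- **Discharge of the named fact** `STV2021_thresholdProbDegree` (Srinivasan–Tripathi–Venkitesh
2021, Thm. 18, positive characteristic, explicit constants `A_p = B_p = 6.4·10⁶·p`): proved from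
`ufam_thr_stv` (the printed induction of §3.1.1 over uniform seed families) and
`hasProbDegree_of_ufam`. [cite: SrinivasanTripathiVenkitesh2021, Theorem 18] -/
theorem STV2021_thresholdProbDegree_holds : STV2021_thresholdProbDegree := by
  intro p _ n t m ts _ _ hts ε hε hε'
  exact hasProbDegree_of_ufam (ufam_thr_stv p n (Fin m) ts t hts ε hε hε')

end Discharge

/-! ### Corollaries of the discharged fact: every field of characteristic `p`; the printed range `ε < 1/3`

(qn-lit g15, 2026-08-27.) Two weakenings in the vendored statement are removed now that it is a
theorem: (i) `TODO(general form)` — the field may be ANY field of characteristic `p` (base change of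
the seed family along `ZMod p →+* F`); (ii) the printed error range of Thm. 18 is `ε ∈ (0, 1/3)`:
for `ε ≥ 2^{-100}` a `2^{-101}`-error poly-tuple is an `ε`-error one, and its degree
`C√(101·t) + 101·C` is at most `11C√(t log₂(1/ε)) + 101·C·log₂(1/ε)` because `log₂(1/ε) > 1`
(STV: "to prove the theorem for all ε ≤ 1/3, we use error reduction … and then apply the result
for small error" — monotonicity in `ε` suffices, at the price of the constants). -/

section Corollaries

/-- **Base change of a uniform seed family** along a ring homomorphism of fields `φ : K →+* F`:
same seeds, functions `φ ∘ G`, same degree (`comp_mem_lowDeg`), same error (a value `[b]_K` maps to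
`[b]_F`). [cite: SrinivasanTripathiVenkitesh2021, Remark 22 (a polynomial over ℤ / the prime field may be interpreted over any field)] -/
theorem UFam.map {K F : Type*} [Field K] [Field F] (φ : K →+* F) {n : ℕ} {κ : Type} [Fintype κ]
    {f : κ → (Fin n → Bool) → Bool} {ε : ℝ} {D : ℕ} (h : UFam K f ε D) : UFam F f ε D := by
  obtain ⟨Ω, hΩ, hne, G, hdeg, herr⟩ := h
  refine ⟨Ω, hΩ, hne, fun ω i b => φ (G ω i b), fun ω i => comp_mem_lowDeg φ (hdeg ω i),
    fun x => le_trans ?_ (herr x)⟩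
  gcongr
  intro ω hω
  rw [mem_errSet] at hω ⊢
  obtain ⟨i, hi⟩ := hω
  refine ⟨i, fun h => hi ?_⟩
  rw [h]
  cases f i x <;> simp [boolVal]

/-- **STV 2021, Thm. 18 over every field of characteristic `p`** (the `TODO(general form)` of the
vendored statement): the same degree bound `stvDegree p t ε` for threshold tuples over any field
`F` with `CharP F p`. [cite: SrinivasanTripathiVenkitesh2021, Theorem 18] -/
theorem STV2021_thresholdProbDegree_charP (p : ℕ) [Fact p.Prime] (F : Type*) [Field F] [CharP F p]
    {n t m : ℕ} (ts : Fin m → ℕ) (hts : ∀ i, ts i ≤ t) {ε : ℝ} (hε : 0 < ε)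
    (hε' : ε < 1 / 2 ^ 100) : HasProbDegree F (fun i => thrFn n (ts i)) ε (stvDegree p t ε) :=
  hasProbDegree_of_ufam ((ufam_thr_stv p n (Fin m) ts t hts ε hε hε').map (ZMod.castHom (dvd_refl p) F))

/-- The degree bound for the full printed error range: `11·C·√(t log₂(1/ε)) + 101·C·log₂(1/ε)`,
`C = 6.4·10⁶·p`. [cite: SrinivasanTripathiVenkitesh2021, Theorem 18 (proof: "to prove the theorem for all ε ≤ 1/3 … apply the result for small error")] -/
def stvDegreeThird (p t : ℕ) (ε : ℝ) : ℕ :=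
  ⌊11 * stvConst p * Real.sqrt (t * Real.logb 2 (1 / ε)) + 101 * stvConst p * Real.logb 2 (1 / ε)⌋₊

/-- **STV 2021, Thm. 18 (positive characteristic) for every `ε ∈ (0, 1/3)`** — the printed range:
`pdeg_ε(T) ≤ 11·A_p√(t log₂(1/ε)) + 101·B_p·log₂(1/ε)` over any field of characteristic `p`.
For `ε < 2^{-100}` this is the theorem above; for `ε ≥ 2^{-100}` the `2^{-101}`-error poly-tuple
serves, its degree `A_p√(101 t) + 101 B_p` being at most the displayed bound because `log₂(1/ε) > 1`.
[cite: SrinivasanTripathiVenkitesh2021, Theorem 18] -/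
theorem STV2021_thresholdProbDegree_lt_third (p : ℕ) [hp : Fact p.Prime] (F : Type*) [Field F]
    [CharP F p] {n t m : ℕ} (ts : Fin m → ℕ) (hts : ∀ i, ts i ≤ t) {ε : ℝ} (hε : 0 < ε)
    (hε3 : ε < 1 / 3) : HasProbDegree F (fun i => thrFn n (ts i)) ε (stvDegreeThird p t ε) := by
  have hC0 : 0 ≤ stvConst p := by unfold stvConst; positivity
  have ht0 : (0 : ℝ) ≤ t := Nat.cast_nonneg _
  have h1ε : 0 < 1 / ε := by positivity
  have hL1 : 1 < Real.logb 2 (1 / ε) := by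
    rw [Real.lt_logb_iff_rpow_lt one_lt_two h1ε, Real.rpow_one, lt_one_div two_pos hε]
    linarith
  set L := Real.logb 2 (1 / ε) with hL
  have hL0 : 0 ≤ L := by linarith
  -- monotonicity of `HasProbDegree` (inlined)
  have mono : ∀ {ε₁ : ℝ} {d₁ : ℕ}, HasProbDegree F (fun i => thrFn n (ts i)) ε₁ d₁ → ε₁ ≤ ε →
      d₁ ≤ stvDegreeThird p t ε → HasProbDegree F (fun i => thrFn n (ts i)) ε (stvDegreeThird p t ε) :=
    fun ⟨μ, hdeg, happ⟩ h1 h2 => ⟨μ, fun P hP i => (hdeg P hP i).trans h2, fun x => (happ x).trans h1⟩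
  by_cases hε' : ε < 1 / 2 ^ 100
  · refine mono (STV2021_thresholdProbDegree_charP p F ts hts hε hε') le_rfl (Nat.floor_le_floor ?_)
    rw [← hL]
    have hs0 : 0 ≤ Real.sqrt (t * L) := Real.sqrt_nonneg _
    nlinarith [mul_nonneg hC0 hs0, mul_nonneg hC0 hL0]
  · push Not at hε'
    have hε₁ : (0 : ℝ) < 1 / 2 ^ 101 := by positivity
    have hε₁' : (1 : ℝ) / 2 ^ 101 < 1 / 2 ^ 100 := by norm_num
    refine mono (STV2021_thresholdProbDegree_charP p F ts hts hε₁ hε₁') (by linarith) ?_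
    -- `stvDegree p t 2^{-101} = ⌊C√(101 t) + 101 C⌋ ≤ ⌊11 C √(tL) + 101 C L⌋`
    have hlog : Real.logb 2 (1 / (1 / (2 : ℝ) ^ 101)) = 101 := by
      rw [one_div_one_div, show ((2 : ℝ) ^ 101) = (2 : ℝ) ^ ((101 : ℕ) : ℝ) by rw [Real.rpow_natCast],
        Real.logb_rpow two_pos (by norm_num)]
      norm_num
    unfold stvDegree stvDegreeThird
    rw [hlog, ← hL]
    refine Nat.floor_le_floor ?_
    have hsq : Real.sqrt (t * 101) ≤ 11 * Real.sqrt (t * L) := by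
      rw [show (11 : ℝ) = Real.sqrt (11 ^ 2) by rw [Real.sqrt_sq]; norm_num, ← Real.sqrt_mul (by norm_num)]
      exact Real.sqrt_le_sqrt (by nlinarith)
    have hs0 : 0 ≤ Real.sqrt (t * L) := Real.sqrt_nonneg _
    nlinarith [mul_le_mul_of_nonneg_left hsq hC0, mul_nonneg hC0 hL0]

end Corollaries

end Smolensky

end Literature.Computability.MetaComplexity
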